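import Literature.Analysis.OperatorTheory.TwistedKernelFluxSectors
import Literature.MathematicalPhysics.QuantumFieldTheory.WilsonFinTorusTwistedPartition
import Literature.MathematicalPhysics.QuantumFieldTheory.WilsonFinTorusHopfSpectralBound
import HarnessLib

/-!
# 't Hooft's electric-flux sectors of the Wilson transfer matrix on the anisotropic four-torus:
# `e^{−βF(e)} = |Γ|⁻¹ Σ_k conj ψ_e(k) Z^{(k)}` is real, non-negative, sums to `Z`, and decays in the non-zero sectors

Topic `Literature/MathematicalPhysics/QuantumFieldTheory`; the Wilson-side companion of
`Literature/Analysis/OperatorTheory/TwistedKernelFluxSectors.lean` (kernel level), built on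
`WilsonFinTorusTwistedPartition.lean` ('t Hooft's temporally twisted partition functions `Z^{(z)} =
wilsonFinTorusTwistedPartition ρ β z b₁ b₂ b₃ n` of the box `b₁ × b₂ × b₃ × n`, the slice twist `finSliceTwist`, its
Haar invariance and the slice-kernel invariance for central twists, the twisted time slicing in iterate form, the exposed
eigenbasis of the transfer operator) and `WilsonFinTorusHopfSpectralBound.lean` (Hopf's ratio bound
`λᵢ ≤ tanh(3Nβ·b₁b₂b₃)·λ₀`).

G. 't Hooft, Nucl. Phys. B 153 (1979) 141, §5: «We wish to compute the free energy F defined by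
e^{−βF} = Tr P(e, m) e^{−βH} (5.1) … P(e, m) = N⁻³ Σ_k e^{−2πi(k·e)/N} Ω[k] (5.2) … Therefore
e^{−βF(e,m;a,β)} = N⁻³ Σ_k e^{−2πi(k·e)/N} Tr Ω[k] e^{−βH} (5.3) … = N⁻³ Σ_k e^{−2πi(k·e)/N} W{k, m; a_μ} (5.4) …
In the limit β → ∞, F becomes the energy of the lowest state with the given flux.»  On the lattice (5.4) is a
DEFINITION; this file types it for the Wilson action of ANY compact group `G`, any continuous unitary `ρ`, any finite
abelian group `Γ` of central temporal twists `φ : Γ → (Fin 4 → G)` (`φ 0 = 1`, `φ (k + k') = φ k · φ k'`, `φ k i ∈ Z(G)` for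
the three spatial slots; e.g. `Γ = (ℤ/N)³ ↪ Z(SU(N))³`), with the flux label a character `ψ ∈ AddChar Γ ℂ` ('t Hooft's
`ψ_e(k) = e^{2πi(k·e)/N}`), and PROVES the transfer-matrix statements behind (5.1)–(5.3):

* `wilsonFinTorusFluxPartition ρ β φ ψ b₁ b₂ b₃ n := |Γ|⁻¹ Σ_k conj ψ(k) · Z^{(φ k)}(b₁,b₂,b₃,n)` — (5.4) (a DEFINITION);
  `wilsonFinTorusFluxPartition_const_one` — no twist, no flux: `φ ≡ 1 ⇒ Z_ψ = Z·[ψ = 0]`;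
* `sum_wilsonFinTorusFluxPartition` — `Σ_ψ Z_ψ = Z` (completeness of the flux projections, every `n`, every real `β`);
  `sum_apply_mul_wilsonFinTorusFluxPartition` — inversion `Z^{(φ k)} = Σ_ψ ψ(k) Z_ψ`;
* ★ `wilsonFinTorusFluxPartition_nonneg` — **`e^{−βF(e)} ≥ 0` and real** for EVERY box `b₁ × b₂ × b₃ × (m+2)` (odd sides
  included), every compact `G`, continuous unitary `ρ`, `β ≥ 0`: the Hamiltonian proof ((5.1): trace of the positive
  operator `𝕋^{m+2}` against a projection commuting with it), here via the kernel-level flux-sector trace formula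
  `Z_ψ(m+2) = Σᵢ λᵢ^m qᵢ(ψ)` with `qᵢ(ψ) = ‖P_ψ κbᵢ‖² ≥ 0`.  The tree's `MultiTwist.electricFluxWeight_nonneg`
  (`ElectricFluxPositivity.lean`) is the REFLECTION-positivity proof of the same sign for `SU(N)` on the symmetric EVEN torus;
  the present theorem needs no reflection and no parity of the sides;
* `re_wilsonFinTorusFluxPartition_le` — `Z_ψ ≤ Z` (`0 ≤ e^{−βF} ≤ 1` after normalisation);
* ★ `exists_fluxSpectralData_wilsonFinTorus` — the spectral content: there is `λ₀ > 0` (the norm of the transfer operator)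
  with `λ₀^{m+2} ≤ Z_0(m+2)` (the VACUUM IS FLUX-FREE, 't Hooft §4), `Z_ψ(2) ≤ Z(2) − λ₀²` and
  **`Z_ψ(m+2) ≤ (tanh(3Nβ·b₁b₂b₃)·λ₀)^m · Z_ψ(2)` for every `ψ ≠ 0`** — the energy of a non-zero electric flux is at
  least the (explicit, volume-dependent) Hopf gap `−log tanh(3Nβ·b₁b₂b₃)` of the box above the vacuum;
* `wilsonFinTorusFluxPartition_zero_pos` — `Z_0(m+2) > 0`.

HONEST FRAMING: finite-volume transfer-matrix bookkeeping at every `β ≥ 0`; the decay rate is Hopf's `tanh(3Nβ·b₁b₂b₃)`,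
which tends to `1` exponentially in the spatial volume — nothing here is a mass gap, an area law, 't Hooft's duality (6.3)
or his light∕heavy flux alternative (§7), and nothing bears on infinite volume.  No bridge to the symmetric-torus vocabulary
`THooftFlux.electricFluxWeight` (`(ℤ/L)^{n+1}`, general twist tensor) is asserted — TODO(general form): identify the two
for purely temporal twists on the cubic box.

References: G. 't Hooft, Nucl. Phys. B 153 (1979) 141, §4 (4.2)–(4.5), §5 (5.1)–(5.4) (reprint: C. Rebbi (ed.), *Lattice
Gauge Theories and Monte Carlo Simulations*, World Scientific 1983, pp. 552–553); J. Greensite, *An Introduction to the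
Confinement Problem* (2011) §4.4 (4.41)–(4.44); E. Hopf, J. Math. Mech. 12 (1963) 683, Thm 4; I. Montvay, G. Münster (1994)
§3.2.6 (3.145); J.-P. Serre, *Linear Representations of Finite Groups* (1977) §2.6 Thm 8.
-/

noncomputable section

open MeasureTheory Filter Function Finset
open scoped ENNReal ComplexConjugate BigOperators
open Literature.Analysis.OperatorTheory

namespace Literature.MathematicalPhysics.QuantumFieldTheory

variable {G : Type*} [Group G] [TopologicalSpace G] [IsTopologicalGroup G] [CompactSpace G]
  [MeasurableSpace G] [BorelSpace G] {N : ℕ} (ρ : G →* Matrix (Fin N) (Fin N) ℂ)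
  {Γ : Type*} [AddCommGroup Γ] [Fintype Γ]

/-- **'t Hooft's electric-flux partition function** of the box `b₁ × b₂ × b₃ × n` in the flux sector `ψ ∈ Γ̂`, for a
finite abelian group `Γ` of temporal twists `φ : Γ → (Fin 4 → G)`:
`Z_ψ := |Γ|⁻¹ Σ_{k ∈ Γ} conj ψ(k) · Z^{(φ k)}` — verbatim (5.4), `e^{−βF(e, m = 0; a, β)} = N⁻³ Σ_k e^{−2πi(k·e)/N} W{k, 0; a_μ}`,
with `W{k, 0; a} = wilsonFinTorusTwistedPartition ρ β (φ k)` and `ψ = ψ_e`, `ψ_e(k) = e^{2πi(k·e)/N}`.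
[cite: tHooft1979Flux, §5 (5.4)] [cite: Greensite2011, §4.4 (4.44)] -/
def wilsonFinTorusFluxPartition (β : ℝ) (φ : Γ → Fin 4 → G) (ψ : AddChar Γ ℂ) (b₁ b₂ b₃ n : ℕ) : ℂ :=
  (Fintype.card Γ : ℂ)⁻¹ * ∑ k, conj (ψ k) * (wilsonFinTorusTwistedPartition ρ β (φ k) b₁ b₂ b₃ n : ℂ)

/-- Unfolding lemma. [cite: tHooft1979Flux, §5 (5.4)] -/
theorem wilsonFinTorusFluxPartition_def (β : ℝ) (φ : Γ → Fin 4 → G) (ψ : AddChar Γ ℂ) (b₁ b₂ b₃ n : ℕ) :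
    wilsonFinTorusFluxPartition ρ β φ ψ b₁ b₂ b₃ n =
      (Fintype.card Γ : ℂ)⁻¹ * ∑ k, conj (ψ k) * (wilsonFinTorusTwistedPartition ρ β (φ k) b₁ b₂ b₃ n : ℂ) := rfl

/-- **Completeness of the flux sectors**: `Σ_ψ Z_ψ = Z^{(φ 0)} = Z` — the flux-projected partition functions add up to
Wilson's partition function (`Σ_e P(e) = 1`; every `n`, every real `β`, only `φ 0 = 1` is used).
[cite: tHooft1979Flux, §5 (5.2)–(5.4)] [cite: Serre1977, §2.6 Thm 8 (ii)] -/
theorem sum_wilsonFinTorusFluxPartition (β : ℝ) {φ : Γ → Fin 4 → G} (hφ0 : φ 0 = 1) (b₁ b₂ b₃ n : ℕ) :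
    ∑ ψ : AddChar Γ ℂ, wilsonFinTorusFluxPartition ρ β φ ψ b₁ b₂ b₃ n = (wilsonFinTorusPartition ρ β b₁ b₂ b₃ n : ℂ) := by
  have h := sum_fluxSector (Γ := Γ) (fun k n' => wilsonFinTorusTwistedPartition ρ β (φ k) b₁ b₂ b₃ n') n
  simp only [hφ0, wilsonFinTorusTwistedPartition_one] at h
  exact h

/-- **Inversion**: `Z^{(φ k)} = Σ_ψ ψ(k) Z_ψ` — each twisted partition function is the character-weighted sum of the flux
sectors (inverting (5.3)∕(5.4)). [cite: tHooft1979Flux, §5 (5.3)–(5.4)] [cite: Serre1977, §2.3 Thm 3 and §2.6 Thm 8 (ii)] -/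
theorem sum_apply_mul_wilsonFinTorusFluxPartition (β : ℝ) (φ : Γ → Fin 4 → G) (b₁ b₂ b₃ n : ℕ) (k₀ : Γ) :
    ∑ ψ : AddChar Γ ℂ, ψ k₀ * wilsonFinTorusFluxPartition ρ β φ ψ b₁ b₂ b₃ n =
      (wilsonFinTorusTwistedPartition ρ β (φ k₀) b₁ b₂ b₃ n : ℂ) :=
  sum_apply_mul_fluxSector (Γ := Γ) (fun k n' => wilsonFinTorusTwistedPartition ρ β (φ k) b₁ b₂ b₃ n') n k₀

/-- **No twist, no flux**: for the trivial twist family `φ ≡ 1` the whole partition function sits in the flux-free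
sector, `Z_ψ = Z·[ψ = 0]` (sanity check of the normalisation `|Γ|⁻¹` and of the character convention).
[cite: tHooft1979Flux, §5 (5.2)–(5.4)] [cite: Serre1977, §2.3 Thm 3] -/
theorem wilsonFinTorusFluxPartition_const_one (β : ℝ) (ψ : AddChar Γ ℂ) (b₁ b₂ b₃ n : ℕ) :
    wilsonFinTorusFluxPartition ρ β (fun _ : Γ => (1 : Fin 4 → G)) ψ b₁ b₂ b₃ n =
      if ψ = 0 then (wilsonFinTorusPartition ρ β b₁ b₂ b₃ n : ℂ) else 0 := by
  classical
  have hcard : (Fintype.card Γ : ℂ) ≠ 0 := Nat.cast_ne_zero.2 Fintype.card_ne_zero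
  rw [wilsonFinTorusFluxPartition_def]
  simp_rw [wilsonFinTorusTwistedPartition_one]
  rw [← Finset.sum_mul, ← mul_assoc]
  have hs : ∑ k, conj (ψ k) = ∑ k, ψ k := by
    simp_rw [← AddChar.map_neg_eq_conj]
    exact Fintype.sum_equiv (Equiv.neg Γ) _ _ fun k => rfl
  rw [hs, AddChar.sum_eq_ite]
  split_ifs with h
  · rw [inv_mul_cancel₀ hcard, one_mul]
  · rw [mul_zero, zero_mul]

section Spectral

variable [SecondCountableTopology G]

/-- **`e^{−βF(e)} ≥ 0` AND REAL, by the transfer matrix** ('t Hooft (5.1)–(5.3) made a theorem about the definition (5.4)):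
for `β ≥ 0`, continuous unitary `ρ`, EVERY box `b₁ × b₂ × b₃ × (m+2)` and every flux label `ψ`,
`0 ≤ Re Z_ψ(m+2)` and `Im Z_ψ(m+2) = 0`.  Mechanism: `Z_ψ(m+2) = Σᵢ λᵢ^m qᵢ(ψ)` with `λᵢ ≥ 0` (Lüscher positivity of the
transfer operator) and `qᵢ(ψ) = ‖P_ψ κbᵢ‖² ≥ 0` (`Literature.Analysis.OperatorTheory.fluxSector_nonneg`).
[cite: tHooft1979Flux, §5 (5.1)–(5.4)] [cite: Luscher1977] -/
theorem wilsonFinTorusFluxPartition_nonneg (hρ : Continuous ρ) (hρu : ∀ g, ρ g ∈ Matrix.unitaryGroup (Fin N) ℂ)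
    {β : ℝ} (hβ : 0 ≤ β) {φ : Γ → Fin 4 → G} (hφ0 : φ 0 = 1) (hφadd : ∀ k k', φ (k + k') = φ k * φ k')
    (hφc : ∀ k (i : Fin 3), φ k i.castSucc ∈ Subgroup.center G) (ψ : AddChar Γ ℂ) (b₁ b₂ b₃ m : ℕ) :
    0 ≤ (wilsonFinTorusFluxPartition ρ β φ ψ b₁ b₂ b₃ (m + 2)).re ∧
      (wilsonFinTorusFluxPartition ρ β φ ψ b₁ b₂ b₃ (m + 2)).im = 0 := by
  haveI : IsFiniteMeasure (haarProbability G) := by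
    dsimp [haarProbability]; infer_instance
  obtain ⟨C, A, s, hcnt, b, lam, i₀, hC, hA, hb, hlam, -, -⟩ := exists_eigenbasis_finTorusSliceKernel hρ hρu hβ b₁ b₂ b₃
  haveI : Countable s := hcnt
  have hK := stronglyMeasurable_uncurry_finTorusSliceKernel (b₁ := b₁) (b₂ := b₂) (b₃ := b₃) ρ hρ β
  have hsymm : ∀ x y : FinSpatialSite b₁ b₂ b₃ × Fin 3 → G,
      finTorusSliceKernel ρ β x y = finTorusSliceKernel ρ β y x := finTorusSliceKernel_symm ρ hρu β
  have hT0 : (finSliceTwist (φ 0) : (FinSpatialSite b₁ b₂ b₃ × Fin 3 → G) → _) = id := by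
    rw [hφ0]; exact finSliceTwist_one
  have hTadd : ∀ (k k' : Γ) (x : FinSpatialSite b₁ b₂ b₃ × Fin 3 → G),
      finSliceTwist (φ (k + k')) x = finSliceTwist (φ k) (finSliceTwist (φ k') x) := fun k k' x => by
    rw [finSliceTwist_finSliceTwist, hφadd]
  exact fluxSector_nonneg (T := fun k => finSliceTwist (φ k)) hK hC hsymm hA hb (fun i => (hlam i).1)
    (fun k => measurePreserving_finSliceTwist (φ k)) hT0 hTadd
    (z := fun k n => wilsonFinTorusTwistedPartition ρ β (φ k) b₁ b₂ b₃ n)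
    (fun k M => wilsonFinTorusTwistedPartition_eq_integral_iterate ρ hρ β (hφc k) b₁ b₂ b₃ M) ψ m

/-- **Each flux sector is at most the whole**: `Re Z_ψ(m+2) ≤ Z(m+2)` (all sectors are `≥ 0` and add up to `Z`) — with
't Hooft's normalisation, `0 ≤ e^{−βF(e)} ≤ 1`; the flux-projected refinement of `Z^{(z)} ≤ Z`.
[cite: tHooft1979Flux, §5 (5.4)] [cite: Kanazawa2008, §2 Lemma 2 eq. (17)–(18)] -/
theorem re_wilsonFinTorusFluxPartition_le (hρ : Continuous ρ) (hρu : ∀ g, ρ g ∈ Matrix.unitaryGroup (Fin N) ℂ)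
    {β : ℝ} (hβ : 0 ≤ β) {φ : Γ → Fin 4 → G} (hφ0 : φ 0 = 1) (hφadd : ∀ k k', φ (k + k') = φ k * φ k')
    (hφc : ∀ k (i : Fin 3), φ k i.castSucc ∈ Subgroup.center G) (ψ : AddChar Γ ℂ) (b₁ b₂ b₃ m : ℕ) :
    (wilsonFinTorusFluxPartition ρ β φ ψ b₁ b₂ b₃ (m + 2)).re ≤ wilsonFinTorusPartition ρ β b₁ b₂ b₃ (m + 2) := by
  have hsum := congrArg Complex.re (sum_wilsonFinTorusFluxPartition ρ β hφ0 b₁ b₂ b₃ (m + 2))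
  rw [Complex.re_sum, Complex.ofReal_re] at hsum
  rw [← hsum]
  exact Finset.single_le_sum
    (fun ψ' _ => (wilsonFinTorusFluxPartition_nonneg ρ hρ hρu hβ hφ0 hφadd hφc ψ' b₁ b₂ b₃ m).1) (Finset.mem_univ ψ)

/-- **THE SPECTRAL CONTENT OF THE FLUX SECTORS** (`β ≥ 0`, continuous unitary `ρ`, any box, any finite abelian group of
central temporal twists).  There is `λ₀ > 0` — the norm of the transfer operator of the spatial box — such that:
(vacuum) `λ₀^m · λ₀² ≤ Re Z_0(m+2)` for every `m` (the flux-free sector carries the Perron–Frobenius ground state: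
«the vacuum has no electric flux», 't Hooft §4); (excited) `Re Z_ψ(2) ≤ Z(2) − λ₀²` for every `ψ ≠ 0`; and
(gap) **`Re Z_ψ(m+2) ≤ (tanh(3Nβ·b₁b₂b₃)·λ₀)^m · Re Z_ψ(2)` for every `ψ ≠ 0` and every `m`** — the free energy per unit
time of any non-zero electric flux exceeds that of the vacuum by at least Hopf's explicit finite-volume gap
`−log tanh(3Nβ·b₁b₂b₃)` («in the limit β → ∞, F becomes the energy of the lowest state with the given flux»).
[cite: tHooft1979Flux, §4 (4.3)–(4.5) and §5 (5.1)–(5.4)] [cite: Hopf1963, Thm 4]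
[cite: ReedSimonIV1978, Thm XIII.43 and Thm XIII.44] -/
theorem exists_fluxSpectralData_wilsonFinTorus (hρ : Continuous ρ) (hρu : ∀ g, ρ g ∈ Matrix.unitaryGroup (Fin N) ℂ)
    {β : ℝ} (hβ : 0 ≤ β) {φ : Γ → Fin 4 → G} (hφ0 : φ 0 = 1) (hφadd : ∀ k k', φ (k + k') = φ k * φ k')
    (hφc : ∀ k (i : Fin 3), φ k i.castSucc ∈ Subgroup.center G) (b₁ b₂ b₃ : ℕ) :
    ∃ lam₀ : ℝ, 0 < lam₀ ∧
      (∀ m : ℕ, lam₀ ^ m * lam₀ ^ 2 ≤ (wilsonFinTorusFluxPartition ρ β φ 0 b₁ b₂ b₃ (m + 2)).re) ∧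
      (∀ ψ : AddChar Γ ℂ, ψ ≠ 0 →
        (wilsonFinTorusFluxPartition ρ β φ ψ b₁ b₂ b₃ 2).re ≤ wilsonFinTorusPartition ρ β b₁ b₂ b₃ 2 - lam₀ ^ 2) ∧
      (∀ ψ : AddChar Γ ℂ, ψ ≠ 0 → ∀ m : ℕ,
        (wilsonFinTorusFluxPartition ρ β φ ψ b₁ b₂ b₃ (m + 2)).re ≤
          (Real.tanh (3 * N * β * ((b₁ : ℝ) * b₂ * b₃)) * lam₀) ^ m *
            (wilsonFinTorusFluxPartition ρ β φ ψ b₁ b₂ b₃ 2).re) := by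
  haveI : IsFiniteMeasure (haarProbability G) := by
    dsimp [haarProbability]; infer_instance
  obtain ⟨C, A, s, hcnt, b, lam, i₀, hC, hA, hb, hlam, hi₀, hL0⟩ :=
    exists_eigenbasis_finTorusSliceKernel hρ hρu hβ b₁ b₂ b₃
  haveI : Countable s := hcnt
  have hK := stronglyMeasurable_uncurry_finTorusSliceKernel (b₁ := b₁) (b₂ := b₂) (b₃ := b₃) ρ hρ β
  have hsymm : ∀ x y : FinSpatialSite b₁ b₂ b₃ × Fin 3 → G,
      finTorusSliceKernel ρ β x y = finTorusSliceKernel ρ β y x := finTorusSliceKernel_symm ρ hρu β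
  have hKpos : ∀ x y : FinSpatialSite b₁ b₂ b₃ × Fin 3 → G, 0 < finTorusSliceKernel ρ β x y :=
    finTorusSliceKernel_pos ρ hρ β
  have hT0 : (finSliceTwist (φ 0) : (FinSpatialSite b₁ b₂ b₃ × Fin 3 → G) → _) = id := by
    rw [hφ0]; exact finSliceTwist_one
  have hTadd : ∀ (k k' : Γ) (x : FinSpatialSite b₁ b₂ b₃ × Fin 3 → G),
      finSliceTwist (φ (k + k')) x = finSliceTwist (φ k) (finSliceTwist (φ k') x) := fun k k' x => by
    rw [finSliceTwist_finSliceTwist, hφadd]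
  have hT : ∀ k : Γ, MeasurePreserving (finSliceTwist (φ k) : (FinSpatialSite b₁ b₂ b₃ × Fin 3 → G) → _)
      (Measure.pi fun _ => haarProbability G) (Measure.pi fun _ => haarProbability G) :=
    fun k => measurePreserving_finSliceTwist (φ k)
  have hKT : ∀ (k : Γ) (x y : FinSpatialSite b₁ b₂ b₃ × Fin 3 → G),
      finTorusSliceKernel ρ β (finSliceTwist (φ k) x) (finSliceTwist (φ k) y) = finTorusSliceKernel ρ β x y :=
    fun k x y => finTorusSliceKernel_finSliceTwist ρ (hφc k) β x y
  have hz : ∀ (k : Γ) (M : ℕ), (fun k n => wilsonFinTorusTwistedPartition ρ β (φ k) b₁ b₂ b₃ n) k (M + 2) =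
      ∫ x, ((fun f : (FinSpatialSite b₁ b₂ b₃ × Fin 3 → G) → ℝ => fun w =>
            ∫ y, finTorusSliceKernel ρ β w y * f y
              ∂(Measure.pi fun _ : FinSpatialSite b₁ b₂ b₃ × Fin 3 => haarProbability G))^[M + 1]
          (fun y => finTorusSliceKernel ρ β y x)) (finSliceTwist (φ k) x)
        ∂(Measure.pi fun _ : FinSpatialSite b₁ b₂ b₃ × Fin 3 => haarProbability G) :=
    fun k M => wilsonFinTorusTwistedPartition_eq_integral_iterate ρ hρ β (hφc k) b₁ b₂ b₃ M
  have hlam0 : ∀ i, 0 ≤ lam i := fun i => (hlam i).1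
  -- Hopf's ratio bound: `λᵢ ≤ τ λ₀` off the top index
  have hHopf : ∀ i, i ≠ i₀ → lam i ≤ Real.tanh (3 * N * β * ((b₁ : ℝ) * b₂ * b₃)) * lam i₀ := fun i hi => by
    have h := WilsonFinTorusHopf.abs_eigenvalue_le_tanh_mul (b₁ := b₁) (b₂ := b₂) (b₃ := b₃) ρ hρ hρu hβ hA b hb hi₀ hi
    rw [← hi₀] at h
    exact (le_abs_self _).trans h
  refine ⟨lam i₀, lt_of_le_of_ne (hlam0 i₀) (Ne.symm hL0), fun m => ?_, fun ψ hψ => ?_, fun ψ hψ m => ?_⟩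
  · exact le_re_fluxSector_zero (T := fun k => finSliceTwist (φ k)) hK hC hsymm hKpos hA hb hlam0 hi₀ hL0 hT hT0
      hTadd hKT hz m
  · have h := re_fluxSector_le_sub (T := fun k => finSliceTwist (φ k)) hK hC hsymm hKpos hA hb hlam0 hi₀ hL0 hT hT0
      hTadd hKT hz hψ
    have h0 : wilsonFinTorusTwistedPartition ρ β (φ 0) b₁ b₂ b₃ 2 = wilsonFinTorusPartition ρ β b₁ b₂ b₃ 2 := by
      rw [hφ0, wilsonFinTorusTwistedPartition_one]
    rw [wilsonFinTorusFluxPartition_def, ← h0]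
    exact h
  · exact re_fluxSector_le_pow_mul (T := fun k => finSliceTwist (φ k)) hK hC hsymm hKpos hA hb hlam0 hi₀ hL0 hHopf hT
      hT0 hTadd hKT hz hψ m

/-- **The flux-free sector is strictly positive**: `0 < Re Z_0(m+2)` (it carries the vacuum term `λ₀^{m+2} > 0`).
[cite: tHooft1979Flux, §4 (4.3)–(4.5) and §5 (5.3)] -/
theorem wilsonFinTorusFluxPartition_zero_pos (hρ : Continuous ρ) (hρu : ∀ g, ρ g ∈ Matrix.unitaryGroup (Fin N) ℂ)
    {β : ℝ} (hβ : 0 ≤ β) {φ : Γ → Fin 4 → G} (hφ0 : φ 0 = 1) (hφadd : ∀ k k', φ (k + k') = φ k * φ k')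
    (hφc : ∀ k (i : Fin 3), φ k i.castSucc ∈ Subgroup.center G) (b₁ b₂ b₃ m : ℕ) :
    0 < (wilsonFinTorusFluxPartition ρ β φ 0 b₁ b₂ b₃ (m + 2)).re := by
  obtain ⟨lam₀, hpos, hvac, -, -⟩ := exists_fluxSpectralData_wilsonFinTorus ρ hρ hρu hβ hφ0 hφadd hφc b₁ b₂ b₃
  exact lt_of_lt_of_le (by positivity) (hvac m)

end Spectral

end Literature.MathematicalPhysics.QuantumFieldTheory

end
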